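/-
Copyright (c) 2026 the pub-hodgecm-mathlib formalisation cell (harness21).  Prover seat hodgecm-mathlib-LH4-p17 (g3) (Track A «FOUR-FRAME» free hand routed to L1 by the
CHAIR VALVE; K1a desk K2Liu-p01 (g11) WORD #5 (c) «(iii) `hcA` stays with the (D-arch-Fub) lineage — one payer for ★ p864498's `hcA` and D-1's `cA`»; block-D desk K2Liu-p12 (g6);
consumer ★ p864498 `K2LiuKindOneSingularArchDecayOfRecord.hAcb_of_archLetters` (binder `hcA`), producer ★ p864260 `K2LiuIncoherentRankOneArchPlaceTensor` (`cA := ↑(c X h)`)),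
Track B «K2-LIT», #184♮ = hLiu418 = `stmt-HodgeConjecture-24832`.  THEOREMS ONLY (no `def`, no instance, no notation, no named-fact hypothesis, no `sorry`, default heartbeats).
-/
import Summits.HodgeConjecture.HodgeConjecture.Theorems.K2LiuIncoherentRankOneArchPlaceTensor    -- ★ p864260 (this seat): `hAinf_of_frameTensor` (brings ★ p863921's D-1 alphabet)
import Literature.NumberTheory.Automorphic.AdelicHeightGLProofs                                  -- ★ `adelicHeightGL` (the height currency of ★ p864498's dictionary)
import HarnessLib

/-!
# Crux `HLiu418`, socket #41 K1-a♮ (L2-dock) × block D row D-1 — (D-arch-Haar-1) THE FRAME-CONSTANT DICTIONARY `hcA` OF ★ p864498 FOR THE HAAR TRANSPORT CONSTANT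
# `cA X h i := ↑(c X h)` OF ★ p864260: a uniform bound `c X h ≤ C₀` IS the dictionary, with all exponents `0`

Cell `hodgecm-mathlib`, crux item hLiu418 = `stmt-HodgeConjecture-24832`, route `HCCMUnconditional`; squad K2 ∕ K2Liu (L1, LEAD F0P6-plan (g15)).  Lane
`--supports stmt-HodgeConjecture-24832 --as helper` (count-neutral).  CLOSES NO SOCKET.

THE SLOT (★ p864498 `K2LiuKindOneSingularArchDecayOfRecord.hAcb_of_archLetters`, (iii) the FRAME-CONSTANT dictionary; K1a desk K2Liu-p01 (g11) WORD #5 (c)):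
  `hcA : ∀ X h, ↑X ≠ 0 → det ↑X = 0 → ∀ d ≥ 1, (d·X integral) → ∀ i ∈ I X h, ‖cA X h i‖ ≤ C₀ · H(h)^{a₀} · (1 + τa X)^{N₀} · d^{Nd₀}`
about the SAME scalar `cA` that splits the archimedean block over the places in D-1 (★ p863921's `hAinf`).  Its producer of record is ★ p864260
`K2LiuIncoherentRankOneArchPlaceTensor.hAinf_of_frameTensor`: `cA X h i := ((c X h : ℝ≥0) : ℂ)`, the HAAR TRANSPORT CONSTANT of the archimedean carrier `ν_{X,h} = νinf (T X h)` through
the tube frame (★ `K2LiuArchUnipotentFrameCoordinates.exists_integral_frame_eq_smul`: `∫ Ψ(Fr u) dν = c • ∫ Ψ(n(r)) dr`) — face-independent, `s`-free, NON-NEGATIVE REAL, and it does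
not see the index `X`, the point `h` or the denominator `d` except through the carrier.  So the dictionary is a UNIFORM BOUND on the transport constants and nothing else:
`‖↑(c X h)‖ = c X h ≤ C₀ = C₀ · H(h)^0 · (1 + τa X)^0 · d^0`.  At the record the constant is moreover CONSTANT — every `νinf T` of ★ `exists_kindW_carrierLetters_haar` is a Haar
measure pinned by `hmap` + `hνK` to one and the same measure ((D-arch-Haar-2), the carrier-uniqueness file: `νinf T = νinf T′`) — so `hcbd` is `le_of_eq`.
THIS FILE (hypothesis-first): **`hcA_of_transportBound`** — ★ p864498's `hcA` binder VERBATIM at `cA := fun X h _ => ((c X h : ℝ) : ℂ)`, `a₀ := 0`, `N₀ := 0`, `Nd₀ := 0`, from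
`hcbd : ∀ X h, (c X h : ℝ) ≤ C₀`; **`hcA_of_constTransport`** — the constant-carrier case `c X h = c₀` (`C₀ := c₀`); `zero_le_of_transportBound` (`0 ≤ C₀` for ★'s `hC₀`, given one
index and point); and §3 **`hAinf_hcA_of_constCarrier`** — ONE PAYER FOR BOTH SLOTS at the carrier of record: with ONE archimedean carrier `ν₀` for all `(X, h)` (★
`K2LiuKindWArchCarrierUniform.νinf_eq_of_factorisation`: `νinf T = νinf T′`) and its ONE transport constant `c₀`, ★ p864260's `hAinf` AND ★ p864498's `hcA` hold together at the
CONSTANT scalar `cA := fun _ _ _ => ↑c₀`.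
HONEST LABEL.  Count-neutral helper (norm of a non-negative real cast, `x^0 = 1`); the bound `hcbd` enters BY VALUE (payer: (D-arch-Haar-2) carrier uniqueness at the record, else any
bound on the family of archimedean carriers); `HC_CM` is proved only modulo the 7 printed citations (2 remaining named inputs: hLiu418 = `stmt-HodgeConjecture-24832`,
h413 = `stmt-HodgeConjecture-24833`) until rung 0 closes.

## References
* [Folland1995] G. B. Folland, *A Course in Abstract Harmonic Analysis* (1995): §2.2 (Haar measure is unique up to a positive constant — the transport constant).
* [Tate1967] J. Tate, *Fourier analysis in number fields and Hecke's zeta-functions* (Cassels–Fröhlich 1967): §3 (factorisation of the adelic Haar measure, normalised local factors).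
* [KudlaRallis1994] S. Kudla, S. Rallis, *A regularized Siegel–Weil formula: the first term identity*, Ann. of Math. 140 (1994): §2 (2.10)–(2.12).
-/

set_option autoImplicit false
set_option linter.dupNamespace false -- the mandated namespace repeats `HodgeConjecture.HodgeConjecture`

noncomputable section

open scoped Matrix NNReal
open NumberField NumberField.InfinitePlace IsDedekindDomain
open Literature.NumberTheory.Automorphic Literature.NumberTheory.Automorphic.UnitaryGroup Literature.NumberTheory.GaloisRepresentations
open Literature.NumberTheory.GelbartRogawski1991 Literature.NumberTheory.GelbartRogawski1991.GRConstruction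

namespace Summit.HodgeConjecture.HodgeConjecture.Cruxes.HLiu418.K2LiuIncoherentRankOneArchHaarConstantBound

open K2LiuSiegelUnipotentFourierDefs

/-! ## §1 Generic: the norm of a bounded non-negative real cast, dressed in ★ p864498's dictionary shape with all exponents zero -/

/-- **THE DICTIONARY SHAPE WITH ZERO EXPONENTS.**  For a non-negative real `c ≤ C₀` and any height `H`, size `τ`, denominator `d`:
`‖(c : ℂ)‖ ≤ C₀ · H^(0:ℝ) · (1 + τ)^0 · d^0`. [cite: Folland1995, §2.2] -/
theorem norm_coe_le_dictionary_zero (c : ℝ≥0) {C₀ : ℝ} (hc : (c : ℝ) ≤ C₀) (H τ dd : ℝ) :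
    ‖((c : ℝ) : ℂ)‖ ≤ C₀ * H ^ (0 : ℝ) * (1 + τ) ^ (0 : ℕ) * dd ^ (0 : ℕ) := by
  rw [Real.rpow_zero, pow_zero, pow_zero, mul_one, mul_one, mul_one, Complex.norm_real, Real.norm_of_nonneg c.coe_nonneg]
  exact hc

/-! ## §2 At the K2_Liu frame: ★ p864498's `hcA` for the transport constant of ★ p864260 -/

section Frame

variable (L : Type) [Field L] [NumberField L] [IsCMField L]

variable {N M n : ℕ} (e : Fin N × Fin M ≃ Fin n)
  (dV : Fin N → L) (hdV : ∀ i, IsCMField.complexConj L (dV i) = dV i)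
  (dW : Fin M → L) (hdW : ∀ i, IsCMField.complexConj L (dW i) = dW i)

/-- **`hcA` FROM A UNIFORM BOUND ON THE TRANSPORT CONSTANTS (the head).**  Faces `I`, archimedean size `τa`, the transport constants `c : Skew → H(𝔸) → ℝ≥0` of ★ p864260 (so
`cA X h i := ↑(c X h)`), and a uniform bound `hcbd : c X h ≤ C₀` ⟹ ★ p864498 `hAcb_of_archLetters`' binder `hcA` VERBATIM at that `cA` with `a₀ := 0`, `N₀ := 0`, `Nd₀ := 0`:
`∀ X h, ↑X ≠ 0 → det ↑X = 0 → ∀ d ≥ 1, (∀ i j, IsIntegral ℤ (d·X i j)) → ∀ i ∈ I X h, ‖cA X h i‖ ≤ C₀ · H(h)^0 · (1 + τa X)^0 · d^0`.  (Pass `(N₀ := 0) (Nd₀ := 0) (ha₀ := le_rfl)` and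
`hC₀ := zero_le_of_transportBound …` to ★.) [cite: Folland1995, §2.2] [cite: Tate1967, §3] [cite: KudlaRallis1994, §2 (2.10)–(2.12)] -/
theorem hcA_of_transportBound {φ : Type*}
    (I : skewMatrices ((IsCMField.complexConj L : L ≃ₐ[Fp L] L) : L →+* L) ((gramR L e dV hdV dW hdW).map (algebraMap (Fp L) L)) → HA L e dV hdV dW hdW → Finset φ)
    (τa : skewMatrices ((IsCMField.complexConj L : L ≃ₐ[Fp L] L) : L →+* L) ((gramR L e dV hdV dW hdW).map (algebraMap (Fp L) L)) → ℝ)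
    (c : skewMatrices ((IsCMField.complexConj L : L ≃ₐ[Fp L] L) : L →+* L) ((gramR L e dV hdV dW hdW).map (algebraMap (Fp L) L)) → HA L e dV hdV dW hdW → ℝ≥0)
    {C₀ : ℝ}
    (hcbd : ∀ (X : skewMatrices ((IsCMField.complexConj L : L ≃ₐ[Fp L] L) : L →+* L) ((gramR L e dV hdV dW hdW).map (algebraMap (Fp L) L))) (h : HA L e dV hdV dW hdW),
      (c X h : ℝ) ≤ C₀) :
    ∀ (X : skewMatrices ((IsCMField.complexConj L : L ≃ₐ[Fp L] L) : L →+* L) ((gramR L e dV hdV dW hdW).map (algebraMap (Fp L) L))) (h : HA L e dV hdV dW hdW),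
      (X : Matrix (Fin n) (Fin n) L) ≠ 0 → (X : Matrix (Fin n) (Fin n) L).det = 0 → ∀ d : ℕ, 1 ≤ d → (∀ i j, IsIntegral ℤ ((d : L) * (X : Matrix (Fin n) (Fin n) L) i j)) →
      ∀ i ∈ I X h, ‖(fun X h (_ : φ) => ((c X h : ℝ) : ℂ)) X h i‖ ≤
        C₀ * adelicHeightGL (n + n) L (h : GL (Fin (n + n)) (AdeleRing (𝓞 L) L)) ^ (0 : ℝ) * (1 + τa X) ^ (0 : ℕ) * (d : ℝ) ^ (0 : ℕ) :=
  fun X h _ _ d _ _ _ _ => norm_coe_le_dictionary_zero (c X h) (hcbd X h) _ (τa X) (d : ℝ)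

/-- **`hcA` FOR A CONSTANT TRANSPORT CONSTANT** (the carrier of record: every `νinf T` is the same Haar measure, (D-arch-Haar-2)): `c X h = c₀` ⟹ the dictionary with `C₀ := c₀`.
[cite: Folland1995, §2.2] [cite: Tate1967, §3] -/
theorem hcA_of_constTransport {φ : Type*}
    (I : skewMatrices ((IsCMField.complexConj L : L ≃ₐ[Fp L] L) : L →+* L) ((gramR L e dV hdV dW hdW).map (algebraMap (Fp L) L)) → HA L e dV hdV dW hdW → Finset φ)
    (τa : skewMatrices ((IsCMField.complexConj L : L ≃ₐ[Fp L] L) : L →+* L) ((gramR L e dV hdV dW hdW).map (algebraMap (Fp L) L)) → ℝ)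
    (c : skewMatrices ((IsCMField.complexConj L : L ≃ₐ[Fp L] L) : L →+* L) ((gramR L e dV hdV dW hdW).map (algebraMap (Fp L) L)) → HA L e dV hdV dW hdW → ℝ≥0)
    (c₀ : ℝ≥0)
    (hconst : ∀ (X : skewMatrices ((IsCMField.complexConj L : L ≃ₐ[Fp L] L) : L →+* L) ((gramR L e dV hdV dW hdW).map (algebraMap (Fp L) L))) (h : HA L e dV hdV dW hdW),
      c X h = c₀) :
    ∀ (X : skewMatrices ((IsCMField.complexConj L : L ≃ₐ[Fp L] L) : L →+* L) ((gramR L e dV hdV dW hdW).map (algebraMap (Fp L) L))) (h : HA L e dV hdV dW hdW),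
      (X : Matrix (Fin n) (Fin n) L) ≠ 0 → (X : Matrix (Fin n) (Fin n) L).det = 0 → ∀ d : ℕ, 1 ≤ d → (∀ i j, IsIntegral ℤ ((d : L) * (X : Matrix (Fin n) (Fin n) L) i j)) →
      ∀ i ∈ I X h, ‖(fun X h (_ : φ) => ((c X h : ℝ) : ℂ)) X h i‖ ≤
        (c₀ : ℝ) * adelicHeightGL (n + n) L (h : GL (Fin (n + n)) (AdeleRing (𝓞 L) L)) ^ (0 : ℝ) * (1 + τa X) ^ (0 : ℕ) * (d : ℝ) ^ (0 : ℕ) :=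
  hcA_of_transportBound L e dV hdV dW hdW I τa c fun X h => by rw [hconst X h]

/-- **`0 ≤ C₀`** for ★ p864498's `hC₀`, given any index and point (the transport constants are non-negative). [cite: Folland1995, §2.2] -/
theorem zero_le_of_transportBound
    (c : skewMatrices ((IsCMField.complexConj L : L ≃ₐ[Fp L] L) : L →+* L) ((gramR L e dV hdV dW hdW).map (algebraMap (Fp L) L)) → HA L e dV hdV dW hdW → ℝ≥0)
    {C₀ : ℝ}
    (hcbd : ∀ (X : skewMatrices ((IsCMField.complexConj L : L ≃ₐ[Fp L] L) : L →+* L) ((gramR L e dV hdV dW hdW).map (algebraMap (Fp L) L))) (h : HA L e dV hdV dW hdW),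
      (c X h : ℝ) ≤ C₀)
    (X₀ : skewMatrices ((IsCMField.complexConj L : L ≃ₐ[Fp L] L) : L →+* L) ((gramR L e dV hdV dW hdW).map (algebraMap (Fp L) L))) (h₀ : HA L e dV hdV dW hdW) :
    0 ≤ C₀ :=
  (c X₀ h₀).coe_nonneg.trans (hcbd X₀ h₀)

/-! ## §3 One payer for both slots at the carrier of record: constant carrier ⟹ `hAinf` (★ p864260) ∧ `hcA` (★ p864498) at the constant scalar -/

/-- **`hAinf` ∧ `hcA` AT THE CARRIER OF RECORD.**  ONE archimedean carrier `ν₀` for every `(X, h)` (★ `K2LiuKindWArchCarrierUniform.νinf_eq_of_factorisation` makes the record's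
`νinf (T X h)` one measure) with its ONE Haar transport constant `c₀` through the frame (`htrans₀`, ★ `exists_integral_frame_eq_smul` at `ν₀`); ★ p864260's other letters
(`hall hAint hpure hAloc`) ⟹ BOTH ★ p863921's `hAinf` (via ★ p864260 `hAinf_of_frameTensor` at `ν := fun _ _ => ν₀`, `c := fun _ _ => c₀`) AND ★ p864498's `hcA` (§2, `C₀ := c₀`,
exponents `0`) at the CONSTANT scalar `cA := fun _ _ _ => ((c₀ : ℝ) : ℂ)` — the «one payer for D-1's `cA` and (L2-dock)'s `hcA`» of K1a desk WORD #5 (c).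
[cite: Folland1995, §2.2] [cite: Tate1967, §3] [cite: KudlaRallis1994, §2 (2.10)–(2.12)] -/
theorem hAinf_hcA_of_constCarrier {φ : Type*} [Fintype {w : InfinitePlace L // w.IsComplex}]
    (I : skewMatrices ((IsCMField.complexConj L : L ≃ₐ[Fp L] L) : L →+* L) ((gramR L e dV hdV dW hdW).map (algebraMap (Fp L) L)) → HA L e dV hdV dW hdW → Finset φ)
    (Tinf : Finset (InfinitePlace L)) (hall : ∀ w : InfinitePlace L, w ∈ Tinf)
    (A : skewMatrices ((IsCMField.complexConj L : L ≃ₐ[Fp L] L) : L →+* L) ((gramR L e dV hdV dW hdW).map (algebraMap (Fp L) L)) → φ → ℂ → HA L e dV hdV dW hdW → ℂ)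
    (τa : skewMatrices ((IsCMField.complexConj L : L ≃ₐ[Fp L] L) : L →+* L) ((gramR L e dV hdV dW hdW).map (algebraMap (Fp L) L)) → ℝ)
    -- ONE carrier for all `(X, h)` and the raw block as an integral against it
    {Ω : Type*} [MeasurableSpace Ω] (ν₀ : MeasureTheory.Measure Ω)
    (F : skewMatrices ((IsCMField.complexConj L : L ≃ₐ[Fp L] L) : L →+* L) ((gramR L e dV hdV dW hdW).map (algebraMap (Fp L) L)) → φ → ℂ → HA L e dV hdV dW hdW → Ω → ℂ)
    (hAint : ∀ X : skewMatrices ((IsCMField.complexConj L : L ≃ₐ[Fp L] L) : L →+* L) ((gramR L e dV hdV dW hdW).map (algebraMap (Fp L) L)),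
      (X : Matrix (Fin n) (Fin n) L) ≠ 0 → (X : Matrix (Fin n) (Fin n) L).det = 0 → ∀ (h : HA L e dV hdV dW hdW), ∀ i ∈ I X h, ∀ s : ℂ, 1 < s.re →
        A X i s h = ∫ u, F X i s h u ∂ν₀)
    -- its ONE transport constant through the frame
    {Mfr R : Type*} [MeasureTheory.MeasureSpace R] [MeasureTheory.SigmaFinite (MeasureTheory.volume : MeasureTheory.Measure R)]
    (Fr : Ω → {w : InfinitePlace L // w.IsComplex} → Mfr) (nfr : {w : InfinitePlace L // w.IsComplex} → R → Mfr) (c₀ : ℝ≥0)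
    (htrans₀ : ∀ Ψ : ({w : InfinitePlace L // w.IsComplex} → Mfr) → ℂ,
      ∫ u, Ψ (Fr u) ∂ν₀ = c₀ • ∫ r : {w : InfinitePlace L // w.IsComplex} → R, Ψ (fun w => nfr w (r w)))
    -- pure-tensor presentation and the local readings (★ p864260's letters)
    (Ψloc : skewMatrices ((IsCMField.complexConj L : L ≃ₐ[Fp L] L) : L →+* L) ((gramR L e dV hdV dW hdW).map (algebraMap (Fp L) L)) → φ →
      {w : InfinitePlace L // w.IsComplex} → ℂ → HA L e dV hdV dW hdW → Mfr → ℂ)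
    (hpure : ∀ X : skewMatrices ((IsCMField.complexConj L : L ≃ₐ[Fp L] L) : L →+* L) ((gramR L e dV hdV dW hdW).map (algebraMap (Fp L) L)),
      (X : Matrix (Fin n) (Fin n) L) ≠ 0 → (X : Matrix (Fin n) (Fin n) L).det = 0 → ∀ (h : HA L e dV hdV dW hdW), ∀ i ∈ I X h, ∀ (s : ℂ) (u : Ω),
        F X i s h u = ∏ w, Ψloc X i w s h (Fr u w))
    (Aloc : skewMatrices ((IsCMField.complexConj L : L ≃ₐ[Fp L] L) : L →+* L) ((gramR L e dV hdV dW hdW).map (algebraMap (Fp L) L)) → φ → InfinitePlace L → ℂ →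
      HA L e dV hdV dW hdW → ℂ)
    (hAloc : ∀ X : skewMatrices ((IsCMField.complexConj L : L ≃ₐ[Fp L] L) : L →+* L) ((gramR L e dV hdV dW hdW).map (algebraMap (Fp L) L)),
      (X : Matrix (Fin n) (Fin n) L) ≠ 0 → (X : Matrix (Fin n) (Fin n) L).det = 0 → ∀ (h : HA L e dV hdV dW hdW), ∀ i ∈ I X h, ∀ (w : InfinitePlace L) (s : ℂ), 1 < s.re →
        Aloc X i w s h = ∫ ρ : R, Ψloc X i ⟨w, IsTotallyComplex.isComplex w⟩ s h (nfr ⟨w, IsTotallyComplex.isComplex w⟩ ρ)) :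
    -- `hAinf` of ★ p863921 at the constant scalar
    (∀ X : skewMatrices ((IsCMField.complexConj L : L ≃ₐ[Fp L] L) : L →+* L) ((gramR L e dV hdV dW hdW).map (algebraMap (Fp L) L)),
      (X : Matrix (Fin n) (Fin n) L) ≠ 0 → (X : Matrix (Fin n) (Fin n) L).det = 0 → ∀ (h : HA L e dV hdV dW hdW), ∀ i ∈ I X h,
        ∀ s : ℂ, 1 < s.re →
          A X i s h = (fun (_ : skewMatrices ((IsCMField.complexConj L : L ≃ₐ[Fp L] L) : L →+* L) ((gramR L e dV hdV dW hdW).map (algebraMap (Fp L) L)))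
            (_ : HA L e dV hdV dW hdW) (_ : φ) => ((c₀ : ℝ) : ℂ)) X h i * ∏ w ∈ Tinf, Aloc X i w s h) ∧
    -- `hcA` of ★ p864498 at the constant scalar, `C₀ := c₀`, exponents `0`
    (∀ (X : skewMatrices ((IsCMField.complexConj L : L ≃ₐ[Fp L] L) : L →+* L) ((gramR L e dV hdV dW hdW).map (algebraMap (Fp L) L))) (h : HA L e dV hdV dW hdW),
      (X : Matrix (Fin n) (Fin n) L) ≠ 0 → (X : Matrix (Fin n) (Fin n) L).det = 0 → ∀ d : ℕ, 1 ≤ d → (∀ i j, IsIntegral ℤ ((d : L) * (X : Matrix (Fin n) (Fin n) L) i j)) →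
      ∀ i ∈ I X h, ‖(fun (_ : skewMatrices ((IsCMField.complexConj L : L ≃ₐ[Fp L] L) : L →+* L) ((gramR L e dV hdV dW hdW).map (algebraMap (Fp L) L)))
            (_ : HA L e dV hdV dW hdW) (_ : φ) => ((c₀ : ℝ) : ℂ)) X h i‖ ≤
        (c₀ : ℝ) * adelicHeightGL (n + n) L (h : GL (Fin (n + n)) (AdeleRing (𝓞 L) L)) ^ (0 : ℝ) * (1 + τa X) ^ (0 : ℕ) * (d : ℝ) ^ (0 : ℕ)) :=
  ⟨K2LiuIncoherentRankOneArchPlaceTensor.hAinf_of_frameTensor L e dV hdV dW hdW I Tinf hall A (fun _ _ => ν₀) F hAint Fr nfr (fun _ _ => c₀) (fun _ _ => htrans₀)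
      Ψloc hpure Aloc hAloc,
    hcA_of_constTransport L e dV hdV dW hdW I τa (fun _ _ => c₀) c₀ (fun _ _ => rfl)⟩

end Frame

end Summit.HodgeConjecture.HodgeConjecture.Cruxes.HLiu418.K2LiuIncoherentRankOneArchHaarConstantBound

end
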